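import Mathlib
import Literature.Computability.AlgebraicComplexity.SkeletonReinstantiation
import Literature.Computability.AlgebraicComplexity.ArithCircuitProofs
import Literature.Computability.AlgebraicComplexity.StandardFamilies
import Literature.Computability.AlgebraicComplexity.RestrictionOfScalars
import HarnessLib

/-!
# LangWeilTransfer — crux `ShatteringExclusion` (stmt-ValiantsHypothesis-6372), line `birth`:
# `stub_lowDegreeConstants` is equivalent to RATIONAL constant descent (kernel-checked calibration)

Route `ValiantsHypothesis/LangWeilTransfer`, crux `ShatteringExclusion`, registered line
`Cruxes/ShatteringExclusion/Lines/birth.lean`, stub `stub_lowDegreeConstants`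
("LowDegreeConstants": `∀ c ∃ c' d₀ N ∀ n ≥ N`, if `per_n` has a fan-in-two `ℂ`-circuit of size
`≤ n^c` then it has one of size `≤ n^{c'}` with all slot constants in an intermediate field
`ℚ ⊆ K ⊆ ℂ`, finite over `ℚ` of degree `≤ n^{d₀}`).

We prove that this stub is EQUIVALENT to the cleaner statement with RATIONAL constants
("RationalDescent": `∀ c ∃ c' N ∀ n ≥ N`, if `per_n` has a fan-in-two `ℂ`-circuit of size `≤ n^c`
then it has a fan-in-two circuit OVER `ℚ` of size `≤ n^{c'}`), i.e. to the nonuniform,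
permanent-specific form of the field-(in)dependence problem for Valiant's hypothesis in
characteristic zero ("does `VP = VNP` over `ℂ` imply `VP = VNP` over `ℚ`?", Bürgisser 2000,
Ch. 4; survey arXiv:2406.06217 §4, Rem. 2.26 (2)):

* `lowDegreeConstants_of_rationalDescent` — a `ℚ`-circuit read in `ℂ` has rational slot constants
  (`slotConst_map`), so RationalDescent gives the stub with `d₀ = 0`, `K = ⊥ = ℚ`.
* `rationalDescent_of_lowDegreeConstants` — conversely, a `ℂ`-circuit whose slot constants lie in
  `K` with `[K:ℚ] ≤ n^{d₀}` descends to a `K`-circuit of thrice the size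
  (`exists_circuit_of_slotConst_eq_comp`, the skeleton run over `K`), and Weil restriction of
  scalars for circuits (Hrubeš–Yehudayoff simulation, tree
  `complexity_le_finrank_pow_three_mul`: `L_ℚ(f) ≤ 16 [K:ℚ]³ L_K(f)`) turns it into a
  `ℚ`-circuit of size `≤ 16 n^{3d₀} · 3 n^{c'}`, polynomial again.
* `lowDegreeConstants_iff_rationalDescent` — the equivalence.

Honest framing (calibration memo, director-valiant 2026-08-27): neither side is provable or
refutable today — RationalDescent is the open constant-elimination problem one step below
Bürgisser's GRH-conditional transfer (TCS 2000 Thm 1.1 / Cor 1.2 need GRH exactly to dispense with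
it), and its negation would be a lower bound for `per_n` over `ℚ` in the presence of small
`ℂ`-circuits. The stub, the crux and the route stay open; VP ≠ VNP is not moved. The companion file
`LangWeilTransferShatteringExclusionAlgebraicConstants.lean` proves the stub WITHOUT its degree
bound; together the two files pin the stub's entire content on the degree of the number field.
-/

noncomputable section

open MvPolynomial

-- the summit and the problem share the name `ValiantsHypothesis` (D-0017 single-conjunct layout)
set_option linter.dupNamespace false

namespace Summit.ValiantsHypothesis.ValiantsHypothesis.Theorems.LangWeilTransfer.ShatteringExclusion

open Literature.Computability.AlgebraicComplexity
open Literature.Computability.AlgebraicComplexity.ArithCircuit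

/-- A fan-in-two circuit over `ℚ` computing the image of an integer polynomial `g`, read in `ℂ`,
is a fan-in-two circuit of the same size computing the image of `g` whose slot constants all lie
in `⊥ = ℚ ⊆ ℂ`. [cite: Burgisser2000, §4.1] -/
theorem exists_rational_constants_of_circuit_rat {σ : Type*} (g : MvPolynomial σ ℤ)
    (Q : ArithCircuit ℚ σ) (h2 : Q.IsFanInTwo) (hQ : Q.Computes (map (Int.castRingHom ℚ) g)) :
    ∃ P : ArithCircuit ℂ σ, P.IsFanInTwo ∧ P.size = Q.size ∧
      P.Computes (map (Int.castRingHom ℂ) g) ∧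
        ∀ v : Fin (4 * P.size + 1), slotConst P v ∈ (⊥ : IntermediateField ℚ ℂ) := by
  refine ⟨Q.map (algebraMap ℚ ℂ), h2.map _, size_map _ _, ?_, fun v => ?_⟩
  · have h := hQ.map (algebraMap ℚ ℂ)
    rwa [map_map, RingHom.eq_intCast' ((algebraMap ℚ ℂ).comp (Int.castRingHom ℚ))] at h
  · rw [slotConst_map]
    exact IntermediateField.mem_bot.2 ⟨_, rfl⟩

/-- A fan-in-two circuit over `ℂ` computing the image of an integer polynomial `g`, all of whose
slot constants lie in an intermediate field `ℚ ⊆ K ⊆ ℂ`, yields a fan-in-two circuit over `K` of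
thrice the size computing the image of `g` (the integer skeleton run over `K`); hence
`L_K(g) ≤ 3 |P|`. [cite: Burgisser2000, §4.1] -/
theorem complexity_le_of_slotConst_mem {σ : Type*} (g : MvPolynomial σ ℤ)
    (K : IntermediateField ℚ ℂ) (P : ArithCircuit ℂ σ) (h2 : P.IsFanInTwo)
    (hP : P.Computes (map (Int.castRingHom ℂ) g))
    (hK : ∀ v : Fin (4 * P.size + 1), slotConst P v ∈ K) :
    complexity (map (Int.castRingHom K) g) ≤ 3 * P.size := by
  obtain ⟨Q, hQ2, hQs, hQc⟩ := exists_circuit_of_slotConst_eq_comp (algebraMap K ℂ)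
    (algebraMap K ℂ).injective P h2 g hP (fun v => ⟨slotConst P v, hK v⟩) (fun v => rfl)
  rw [← hQs]
  exact complexity_le_size hQ2 hQc

/-- **RationalDescent ⟹ LowDegreeConstants** (with `d₀ = 0`, `K = ℚ`). The conclusion is the
registered signature of `stub_lowDegreeConstants` verbatim. [folklore] -/
theorem lowDegreeConstants_of_rationalDescent
    (h : ∀ c : ℕ, ∃ c' N : ℕ, ∀ n ≥ N,
      (∃ P : ArithCircuit ℂ (Fin n × Fin n),
          P.IsFanInTwo ∧ P.size ≤ n ^ c ∧ P.Computes (perPoly (Fin n) ℂ)) →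
        ∃ Q : ArithCircuit ℚ (Fin n × Fin n),
          Q.IsFanInTwo ∧ Q.size ≤ n ^ c' ∧ Q.Computes (perPoly (Fin n) ℚ)) :
    ∀ c : ℕ, ∃ c' d₀ N : ℕ, ∀ n ≥ N,
      (∃ P : ArithCircuit ℂ (Fin n × Fin n),
          P.IsFanInTwo ∧ P.size ≤ n ^ c ∧ P.Computes (perPoly (Fin n) ℂ)) →
        ∃ P : ArithCircuit ℂ (Fin n × Fin n),
          P.IsFanInTwo ∧ P.size ≤ n ^ c' ∧ P.Computes (perPoly (Fin n) ℂ) ∧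
            ∃ K : IntermediateField ℚ ℂ, FiniteDimensional ℚ K ∧ Module.finrank ℚ K ≤ n ^ d₀ ∧
              ∀ v : Fin (4 * P.size + 1), slotConst P v ∈ K := by
  intro c
  obtain ⟨c', N, hN⟩ := h c
  refine ⟨c', 0, N, fun n hn hex => ?_⟩
  obtain ⟨Q, hQ2, hQs, hQc⟩ := hN n hn hex
  have hQc' : Q.Computes (map (Int.castRingHom ℚ) (perPoly (Fin n) ℤ)) := by rwa [map_perPoly]
  obtain ⟨P, hP2, hPs, hPc, hmem⟩ := exists_rational_constants_of_circuit_rat _ Q hQ2 hQc'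
  refine ⟨P, hP2, hPs ▸ hQs, by rwa [map_perPoly] at hPc, ⊥, ?_, ?_, hmem⟩
  · infer_instance
  · rw [IntermediateField.finrank_bot, pow_zero]

/-- **LowDegreeConstants ⟹ RationalDescent.** The hypothesis is the registered signature of
`stub_lowDegreeConstants` verbatim; the proof descends the circuit to its field of constants `K`
(`complexity_le_of_slotConst_mem`) and applies Weil restriction of scalars for circuits
(`complexity_le_finrank_pow_three_mul`, `L_ℚ ≤ 16 [K:ℚ]³ L_K`), so the new exponent is
`c' + 3 d₀ + 6`. [cite: Burgisser2000, §4.1] -/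
theorem rationalDescent_of_lowDegreeConstants
    (h : ∀ c : ℕ, ∃ c' d₀ N : ℕ, ∀ n ≥ N,
      (∃ P : ArithCircuit ℂ (Fin n × Fin n),
          P.IsFanInTwo ∧ P.size ≤ n ^ c ∧ P.Computes (perPoly (Fin n) ℂ)) →
        ∃ P : ArithCircuit ℂ (Fin n × Fin n),
          P.IsFanInTwo ∧ P.size ≤ n ^ c' ∧ P.Computes (perPoly (Fin n) ℂ) ∧
            ∃ K : IntermediateField ℚ ℂ, FiniteDimensional ℚ K ∧ Module.finrank ℚ K ≤ n ^ d₀ ∧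
              ∀ v : Fin (4 * P.size + 1), slotConst P v ∈ K) :
    ∀ c : ℕ, ∃ c' N : ℕ, ∀ n ≥ N,
      (∃ P : ArithCircuit ℂ (Fin n × Fin n),
          P.IsFanInTwo ∧ P.size ≤ n ^ c ∧ P.Computes (perPoly (Fin n) ℂ)) →
        ∃ Q : ArithCircuit ℚ (Fin n × Fin n),
          Q.IsFanInTwo ∧ Q.size ≤ n ^ c' ∧ Q.Computes (perPoly (Fin n) ℚ) := by
  intro c
  obtain ⟨c', d₀, N, hN⟩ := h c
  refine ⟨c' + 3 * d₀ + 6, max N 2, fun n hn hex => ?_⟩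
  have hnN : N ≤ n := le_trans (le_max_left _ _) hn
  have hn2 : 2 ≤ n := le_trans (le_max_right _ _) hn
  obtain ⟨P, hP2, hPs, hPc, K, hKfd, hKdeg, hmem⟩ := hN n hnN hex
  haveI := hKfd
  have hPc' : P.Computes (map (Int.castRingHom ℂ) (perPoly (Fin n) ℤ)) := by rwa [map_perPoly]
  -- `L_K(per_n) ≤ 3 |P|`
  have hLK : complexity (perPoly (Fin n) K) ≤ 3 * P.size := by
    have h1 := complexity_le_of_slotConst_mem _ K P hP2 hPc' hmem
    rwa [map_perPoly] at h1
  -- `L_ℚ(per_n) ≤ 16 [K:ℚ]³ L_K(per_n)`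
  have hLQ : complexity (perPoly (Fin n) ℚ) ≤
      16 * Module.finrank ℚ K ^ 3 * complexity (perPoly (Fin n) K) := by
    have h1 := complexity_le_finrank_pow_three_mul (E := K) (perPoly (Fin n) ℚ)
    rwa [map_perPoly] at h1
  obtain ⟨Q, hQ2, hQc, hQs⟩ := exists_computes_size_eq_complexity (perPoly (Fin n) ℚ)
  refine ⟨Q, hQ2, ?_, hQc⟩
  rw [hQs]
  -- bookkeeping: `16 [K:ℚ]³ · 3|P| ≤ n^4 · n^{3d₀} · n^2 · n^{c'}`
  have h16 : 16 ≤ n ^ 4 := by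
    calc 16 = 2 ^ 4 := by norm_num
      _ ≤ n ^ 4 := Nat.pow_le_pow_left hn2 4
  have h3 : 3 ≤ n ^ 2 := by
    calc 3 ≤ 2 ^ 2 := by norm_num
      _ ≤ n ^ 2 := Nat.pow_le_pow_left hn2 2
  have hD : Module.finrank ℚ K ^ 3 ≤ n ^ (3 * d₀) := by
    rw [pow_mul']
    exact Nat.pow_le_pow_left hKdeg 3
  calc complexity (perPoly (Fin n) ℚ)
      ≤ 16 * Module.finrank ℚ K ^ 3 * complexity (perPoly (Fin n) K) := hLQ
    _ ≤ 16 * Module.finrank ℚ K ^ 3 * (3 * P.size) := Nat.mul_le_mul_left _ hLK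
    _ ≤ n ^ 4 * n ^ (3 * d₀) * (n ^ 2 * n ^ c') := by gcongr
    _ = n ^ (c' + 3 * d₀ + 6) := by ring

/-- **Calibration of `stub_lowDegreeConstants`** (crux `ShatteringExclusion`, line `birth`): the
registered stub (left) is equivalent to RATIONAL constant descent for the permanent (right) — the
nonuniform, `per`-specific form of "`VP_ℂ = VNP_ℂ ⟹ VP_ℚ = VNP_ℚ`", an open problem
(Bürgisser 2000 Ch. 4; arXiv:2406.06217 §4). [cite: Burgisser2000, §4.1] -/
theorem lowDegreeConstants_iff_rationalDescent :
    (∀ c : ℕ, ∃ c' d₀ N : ℕ, ∀ n ≥ N,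
      (∃ P : ArithCircuit ℂ (Fin n × Fin n),
          P.IsFanInTwo ∧ P.size ≤ n ^ c ∧ P.Computes (perPoly (Fin n) ℂ)) →
        ∃ P : ArithCircuit ℂ (Fin n × Fin n),
          P.IsFanInTwo ∧ P.size ≤ n ^ c' ∧ P.Computes (perPoly (Fin n) ℂ) ∧
            ∃ K : IntermediateField ℚ ℂ, FiniteDimensional ℚ K ∧ Module.finrank ℚ K ≤ n ^ d₀ ∧
              ∀ v : Fin (4 * P.size + 1), slotConst P v ∈ K) ↔
    (∀ c : ℕ, ∃ c' N : ℕ, ∀ n ≥ N,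
      (∃ P : ArithCircuit ℂ (Fin n × Fin n),
          P.IsFanInTwo ∧ P.size ≤ n ^ c ∧ P.Computes (perPoly (Fin n) ℂ)) →
        ∃ Q : ArithCircuit ℚ (Fin n × Fin n),
          Q.IsFanInTwo ∧ Q.size ≤ n ^ c' ∧ Q.Computes (perPoly (Fin n) ℚ)) :=
  ⟨rationalDescent_of_lowDegreeConstants, lowDegreeConstants_of_rationalDescent⟩

/-- A polynomial has a fan-in-two circuit of size `≤ s` iff its circuit complexity is `≤ s`
(definition of `complexity` as the minimal size). [folklore] -/
theorem exists_circuit_size_le_iff_complexity_le {k : Type*} [CommSemiring k] {σ : Type*}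
    (f : MvPolynomial σ k) (s : ℕ) :
    (∃ P : ArithCircuit k σ, P.IsFanInTwo ∧ P.size ≤ s ∧ P.Computes f) ↔ complexity f ≤ s := by
  constructor
  · rintro ⟨P, h2, hs, hc⟩
    exact (complexity_le_size h2 hc).trans hs
  · intro h
    obtain ⟨P, h2, hc, hs⟩ := exists_computes_size_eq_complexity f
    exact ⟨P, h2, hs ▸ h, hc⟩

/-- **The calibration in the tree's vocabulary `complexity` (`L_k`).** The registered stub
`stub_lowDegreeConstants` is equivalent to: for every `c` there are `c', N` with
`L_ℂ(per_n) ≤ n^c ⟹ L_ℚ(per_n) ≤ n^{c'}` for all `n ≥ N` — polynomially bounded complexity of the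
permanent over `ℂ` forces polynomially bounded complexity over `ℚ` (nonuniformly). This is the
per-specific, nonuniform form of the field-independence problem for Valiant's hypothesis in
characteristic zero (Bürgisser 2000, Ch. 4), open. [cite: Burgisser2000, §4.1] -/
theorem lowDegreeConstants_iff_complexity_descent :
    (∀ c : ℕ, ∃ c' d₀ N : ℕ, ∀ n ≥ N,
      (∃ P : ArithCircuit ℂ (Fin n × Fin n),
          P.IsFanInTwo ∧ P.size ≤ n ^ c ∧ P.Computes (perPoly (Fin n) ℂ)) →
        ∃ P : ArithCircuit ℂ (Fin n × Fin n),
          P.IsFanInTwo ∧ P.size ≤ n ^ c' ∧ P.Computes (perPoly (Fin n) ℂ) ∧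
            ∃ K : IntermediateField ℚ ℂ, FiniteDimensional ℚ K ∧ Module.finrank ℚ K ≤ n ^ d₀ ∧
              ∀ v : Fin (4 * P.size + 1), slotConst P v ∈ K) ↔
    (∀ c : ℕ, ∃ c' N : ℕ, ∀ n ≥ N,
      complexity (perPoly (Fin n) ℂ) ≤ n ^ c → complexity (perPoly (Fin n) ℚ) ≤ n ^ c') := by
  rw [lowDegreeConstants_iff_rationalDescent]
  refine forall_congr' fun c => ?_
  simp only [exists_circuit_size_le_iff_complexity_le]

end Summit.ValiantsHypothesis.ValiantsHypothesis.Theorems.LangWeilTransfer.ShatteringExclusion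

end
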